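import Literature.Probability.RandomPlanarGeometry.SAWIrreducibleBridgeRatioLimit
import Literature.Probability.RandomPlanarGeometry.SAWBridgeTwoStepRate
import HarnessLib

/-!
# A Kesten-type RATE for the irreducible-bridge two-step ratio: `|λ_{N+2}/λ_N − μ²| ≤ K N^{-1/4}` (lane «pcv-sawmu», route R52 «IRR-RATIO-RATE»)

Topic `Literature/Probability/RandomPlanarGeometry` (continues `SAWIrreducibleBridgeRatioLimit.lean`: Kesten's inequality for
irreducible bridges `kesten_ineq_irreducible`, the ratio limit `tendsto_irreducibleBridgeCount_ratio_two` (lane route R42), the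
engine family `irrFam`; `SAWBridgeTwoStepRate.lean`: the abstract upper-rate engine `upper_rate_core`;
`SAWIrreducibleBridgeGrowth.lean`: the explicit envelope `e^{-(3c₁+48+5μ)√N} μ^N ≤ λ_N`).

Source: N. Madras, G. Slade, *The Self-Avoiding Walk* (1993), §7.3: Theorem 7.3.4 (p. 248) gives the ratio
LIMITS `a_{N+2}/a_N → μ²` for `a = c_N, c_N(0,x), q_{2N}, b_N`; the printed RATES `|a_{N+2}/a_N − μ²| ≤ K N^{-1/3}`
are Kesten's, §7.5 Notes (7.5.1)–(7.5.2) (p. 255), and exist for `c_N` and `c_N(0,x)` ONLY (no printed rate for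
`b_N`; `N^{-1/4}`-type rates follow from the `e^{O(√N)}` envelopes by the method of Theorem 7.3.4); the
irreducible-bridge counts `λ_N` are NOT covered in print (they are neither sub- nor super-multiplicative). Lane
«pcv-sawmu», a-idea-1 ROUTES-G11 §R52 / `Sketch_G11.lean` (objects `irrRatio`, `IrrTwoStepRate` and the five statements
VERBATIM): **`irrBridgeTwoStepRate (d) : ∃ K N₀, ∀ N ≥ N₀, |λ_{N+2}/λ_N − μ²| ≤ K N^{-1/4}`** on every `ℤ^{d+2}`.

## Proof architecture
* `irrRatio_additiveStep` — Kesten's inequality in ADDITIVE form `φ_n − D/n ≤ φ_{n+2}` (divide (7.3.4) by the eventual floor `φ_n ≥ μ²/2`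
  supplied by the ratio limit theorem);
* `irrRatio_upperRate` — the UPPER rate from `upper_rate_core` run on the engine family `a_n = |irrFam d n|` (`= λ_n` for `n ≥ 1`,
  `= 1` at `n = 0`, dodging `λ_0 = 0`), with the all-`n` lower envelope `exp_mul_pow_le_irrFam`;
* `backwardEnvelope_rate` — the LOWER rate for an arbitrary positive sequence with the additive Kesten step and the envelope
  `e^{-c√n}μ^n ≤ a_n ≤ μ^n`, by BACKWARD propagation of a deviation `φ_N = μ² − u` over `M ≍ uN/D ∧ N/4` steps
  (`kesten_iter_backward_of_threshold`), `a_{N+2} ≤ a_{N−2M}(μ² − u/2)^{M+1}` against the envelope (abstract lemma, a-p1 g5);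
* `irrRatio_lowerRate` — S3 on the engine family; `irrTwoStepRate_of_rates` — assembly.
Refute-first (a-ref-1 g21, exact `λ_n`, `n ≤ 40`): `N^{1/4}|φ_N − μ²| ≤ 4.14`, decreasing from `N = 17`; SURVIVES.
Tree-twin search: stems `irrRatio`, `IrrTwoStep`, `irreducible.*rate` → only the limit theorem of R42. No twin.
-/

noncomputable section

open Finset Filter Topology
open scoped BigOperators

namespace Literature.Probability.RandomPlanarGeometry.SAW.Zd

open Literature.Probability.LatticeModels Literature.Probability.Percolation

variable {d : ℕ}

/-- `φ_N := λ_{N+2}/λ_N` on `ℤ^{d+2}` (irreducible bridges). (Planner's object, a-idea-1 `Sketch_G11.lean` §R52, verbatim.)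
[cite: MadrasSlade1993, Definition 4.2.1 (irreducible bridges) and §7.3 (two-step ratios)] -/
def irrRatio (d N : ℕ) : ℝ :=
  (irreducibleBridgeCount (d + 2) (N + 2) : ℝ) / irreducibleBridgeCount (d + 2) N

/-- R52 TARGET: `|λ_{N+2}/λ_N − μ²| ≤ K N^{-1/4}` for all `N ≥ N₀` (every `ℤ^{d+2}`). (Planner's object, verbatim.) Not in print:
Madras–Slade Theorem 7.3.4 (p. 248) lists the ratio LIMITS for `c_N, c_N(0,x), q_{2N}, b_N` — none for `λ_N` — and
the printed rates (§7.5 Notes (7.5.1)–(7.5.2), p. 255) are for `c_N`, `c_N(0,x)` only; the tree's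
`tendsto_irreducibleBridgeCount_ratio_two` is the limit for `λ_N`, no rate.
[cite: MadrasSlade1993, Theorem 7.3.4 (p. 248: ratio limits for c_N, c_N(0,x), q_{2N}, b_N — none for λ_N) and §7.5 Notes (7.5.1)–(7.5.2) (p. 255: Kesten's rates, for c_N and c_N(0,x) only)] -/
def IrrTwoStepRate (d : ℕ) (K : ℝ) (N₀ : ℕ) : Prop :=
  ∀ N : ℕ, N₀ ≤ N → |irrRatio d N - connectiveConstant (d + 2) ^ 2| ≤ K * (N : ℝ) ^ (-(1 : ℝ) / 4)

/-! ### The engine family `a_n = |irrFam d n|` (`= λ_n` for `n ≥ 1`, `= 1` at `n = 0`) -/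

/-- `a (n+2) / a n = φ_n` for `n ≥ 1`. [cite: MadrasSlade1993, Theorem 7.3.2 (proof: the family W_N)] -/
theorem irrFam_ratio_eq_irrRatio {n : ℕ} (hn : 1 ≤ n) :
    ((irrFam d (n + 2)).card : ℝ) / (irrFam d n).card = irrRatio d n := by
  rw [card_irrFam_of_ne (show n ≠ 0 by omega), card_irrFam_of_ne (show n + 2 ≠ 0 by omega)]
  rfl

/-- The engine family is positive (as reals). [cite: MadrasSlade1993, Theorem 7.3.2 (proof)] -/
theorem irrFam_card_pos (d n : ℕ) : (0 : ℝ) < (irrFam d n).card := by exact_mod_cast irrFam_pos d n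

/-- **The explicit lower envelope for the engine family, for ALL `n`**: with `c = 3·c₁ + 48 + 5μ`
(`exp_mul_pow_le_irreducibleBridgeCount_explicit` for `n ≥ 3`; `n ≤ 2` by `e^{-c√n} μ^n ≤ 1 ≤ a_n`).
[cite: MadrasSlade1993, Corollary 4.4.5 (proof), Corollary 3.1.6] -/
theorem exp_mul_pow_le_irrFam (d n : ℕ) :
    Real.exp (-((3 * (count (d + 2) 1 : ℝ) + 48 + 5 * connectiveConstant (d + 2)) * Real.sqrt n)) *
        connectiveConstant (d + 2) ^ n ≤ (irrFam d n).card := by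
  set μ := connectiveConstant (d + 2) with hμ
  set c : ℝ := 3 * (count (d + 2) 1 : ℝ) + 48 + 5 * μ with hc
  have hμ1 : 1 ≤ μ := one_le_connectiveConstant (d + 2)
  rcases Nat.lt_or_ge n 3 with hn | hn
  · -- `n ≤ 2`: `e^{-c√n} μ^n ≤ 1 ≤ a_n`
    have h1 : (1 : ℝ) ≤ (irrFam d n).card := by exact_mod_cast irrFam_pos d n
    refine le_trans ?_ h1
    -- `n log μ ≤ c √n` since `log μ ≤ μ - 1 ≤ μ`, `n ≤ 2 √n` for `n ≤ 2`... we use `μ^n ≤ exp(n μ)` and `n ≤ 2√n ≤ 5√n`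
    have hlogμ : Real.log μ ≤ μ := by
      have := Real.log_le_sub_one_of_pos (lt_of_lt_of_le one_pos hμ1); linarith
    have hsq : (n : ℝ) ≤ 2 * Real.sqrt n := by
      have hn2 : (n : ℝ) ≤ 2 := by exact_mod_cast (by omega : n ≤ 2)
      have hs := Real.sq_sqrt (Nat.cast_nonneg n)
      nlinarith [Real.sqrt_nonneg (n : ℝ), hs]
    have hpow : μ ^ n = Real.exp (n * Real.log μ) := by
      rw [← Real.exp_log (pow_pos (lt_of_lt_of_le one_pos hμ1) n), Real.log_pow]
    rw [hpow, ← Real.exp_add]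
    apply Real.exp_le_one_iff.2
    have hc5 : 5 * μ ≤ c := by rw [hc]; have : (0 : ℝ) ≤ count (d + 2) 1 := Nat.cast_nonneg _; linarith
    have : (n : ℝ) * Real.log μ ≤ 2 * Real.sqrt n * μ := by
      have h0 : 0 ≤ Real.log μ := Real.log_nonneg hμ1
      calc (n : ℝ) * Real.log μ ≤ (2 * Real.sqrt n) * Real.log μ := mul_le_mul_of_nonneg_right hsq h0
        _ ≤ 2 * Real.sqrt n * μ := mul_le_mul_of_nonneg_left hlogμ (by positivity)
    nlinarith [Real.sqrt_nonneg (n : ℝ), lt_of_lt_of_le one_pos hμ1]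
  · rw [card_irrFam_of_ne (show n ≠ 0 by omega)]
    exact exp_mul_pow_le_irreducibleBridgeCount_explicit (d := d + 2) (by omega) n hn

/-! ### S1 — Kesten's inequality for `λ` in additive form -/

/-- **R52-S1**: `φ_n − D/n ≤ φ_{n+2}` for all large `n`, some `D ≥ 1` (Kesten's (7.3.4) for irreducible bridges,
`kesten_ineq_irreducible`, divided by the eventual floor `φ_n ≥ μ²/2` from the ratio limit theorem).
[cite: MadrasSlade1993, Theorem 7.3.2 and Lemma 7.3.1 (eq. (7.3.3))] -/
theorem irrRatio_additiveStep (d : ℕ) : ∃ D : ℝ, 1 ≤ D ∧ ∃ N₁ : ℕ, ∀ n : ℕ, N₁ ≤ n →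
    irrRatio d n - D / n ≤ irrRatio d (n + 2) := by
  have hμ := connectiveConstant_pos (d + 2)
  set μ := connectiveConstant (d + 2) with hμdef
  obtain ⟨D, hD⟩ := kesten_ineq_irreducible d
  have hlim := tendsto_irreducibleBridgeCount_ratio_two d
  -- eventual floor `φ_n ≥ μ²/2`
  have hfloor : ∀ᶠ n : ℕ in atTop, μ ^ 2 / 2 ≤ irrRatio d n := by
    have h := hlim.eventually (Ici_mem_nhds (show μ ^ 2 / 2 < μ ^ 2 by nlinarith [pow_pos hμ 2]))
    exact h.mono fun n hn => hn
  set c₀ : ℝ := μ ^ 2 / 2 with hc₀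
  have hc₀pos : 0 < c₀ := by positivity
  refine ⟨max 1 (max D 0 / c₀), le_max_left _ _, ?_⟩
  obtain ⟨N₁, hN₁⟩ := Filter.eventually_atTop.1 (hD.and (hfloor.and (eventually_ge_atTop 1)))
  refine ⟨N₁, fun n hn => ?_⟩
  obtain ⟨hK, hfl, hn1⟩ := hN₁ n hn
  change irrRatio d n ^ 2 - D / n ≤ irrRatio d n * irrRatio d (n + 2) at hK
  have hφpos : 0 < irrRatio d n := lt_of_lt_of_le hc₀pos hfl
  have hn0 : (0 : ℝ) < n := by exact_mod_cast (show 0 < n by omega)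
  -- `φ_{n+2} ≥ φ_n − D/(n φ_n) ≥ φ_n − D⁺/(c₀ n) ≥ φ_n − D'/n`
  have h1 : irrRatio d n - D / (n * irrRatio d n) ≤ irrRatio d (n + 2) := by
    have := div_le_div_of_nonneg_right hK hφpos.le
    rw [sub_div, pow_two, mul_div_assoc, div_self hφpos.ne', mul_one, mul_comm (irrRatio d n) (irrRatio d (n + 2)),
      mul_div_assoc, div_self hφpos.ne', mul_one, div_div] at this
    exact this
  have h2 : D / (n * irrRatio d n) ≤ max 1 (max D 0 / c₀) / n := by
    rw [div_le_div_iff₀ (by positivity) hn0]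
    have hDle : D ≤ max D 0 := le_max_left _ _
    have hge : max D 0 / c₀ ≤ max 1 (max D 0 / c₀) := le_max_right _ _
    have hD0 : 0 ≤ max D 0 := le_max_right _ _
    -- `D · n ≤ (D⁺/c₀) · (n φ)` since `φ ≥ c₀`
    calc D * n ≤ max D 0 * n := mul_le_mul_of_nonneg_right hDle hn0.le
      _ = (max D 0 / c₀) * (n * c₀) := by field_simp
      _ ≤ (max D 0 / c₀) * (n * irrRatio d n) :=
          mul_le_mul_of_nonneg_left (mul_le_mul_of_nonneg_left hfl hn0.le) (div_nonneg hD0 hc₀pos.le)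
      _ ≤ max 1 (max D 0 / c₀) * (n * irrRatio d n) := mul_le_mul_of_nonneg_right hge (by positivity)
  linarith

/-- S1 transported to the engine family `a_n = |irrFam d n|` (same values for `n ≥ 1`).
[cite: MadrasSlade1993, Theorem 7.3.2 and Lemma 7.3.1] -/
theorem irrFam_kesten_additive (d : ℕ) : ∃ D : ℝ, 1 ≤ D ∧ ∃ N₁ : ℕ, 1 ≤ N₁ ∧ ∀ n : ℕ, N₁ ≤ n →
    ((irrFam d (n + 2)).card : ℝ) / (irrFam d n).card - D / n ≤
      ((irrFam d (n + 4)).card : ℝ) / (irrFam d (n + 2)).card := by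
  obtain ⟨D, hD1, N₁, h⟩ := irrRatio_additiveStep d
  refine ⟨D, hD1, max N₁ 1, le_max_right _ _, fun n hn => ?_⟩
  have hn1 : 1 ≤ n := le_trans (le_max_right _ _) hn
  rw [irrFam_ratio_eq_irrRatio hn1, show n + 4 = (n + 2) + 2 by ring, irrFam_ratio_eq_irrRatio (by omega)]
  exact h n (le_trans (le_max_left _ _) hn)

/-! ### S2 — the upper rate -/

/-- **R52-S2**: `φ_N − μ² ≤ K N^{-1/4}` — the tree's abstract `upper_rate_core` run for `a_n = |irrFam d n|`.
[cite: MadrasSlade1993, Theorem 7.3.4 (method of proof: (7.3.18)–(7.3.23)), Corollary 3.1.6] -/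
theorem irrRatio_upperRate (d : ℕ) : ∃ K : ℝ, 0 ≤ K ∧ ∃ N₀ : ℕ, ∀ N : ℕ, N₀ ≤ N →
    irrRatio d N - connectiveConstant (d + 2) ^ 2 ≤ K * (N : ℝ) ^ (-(1 : ℝ) / 4) := by
  have hμ := connectiveConstant_pos (d + 2)
  set μ := connectiveConstant (d + 2) with hμdef
  set c : ℝ := 3 * (count (d + 2) 1 : ℝ) + 48 + 5 * μ with hc
  have hc0 : 0 ≤ c := by rw [hc]; have : (0 : ℝ) ≤ count (d + 2) 1 := Nat.cast_nonneg _; nlinarith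
  obtain ⟨D, hD1, N₁, hN₁1, hK⟩ := irrFam_kesten_additive d
  have hD0 : 0 ≤ D := by linarith
  have hK₁0 : 0 ≤ Real.sqrt (8 * μ ^ 2 * D * (c + 1)) + 2 * D * (2 * c + 1) := by positivity
  refine ⟨Real.sqrt (8 * μ ^ 2 * D * (c + 1)) + 2 * D * (2 * c + 1), hK₁0, N₁, fun N hN => ?_⟩
  set K₁ : ℝ := Real.sqrt (8 * μ ^ 2 * D * (c + 1)) + 2 * D * (2 * c + 1) with hK₁
  have hN1 : 1 ≤ N := le_trans hN₁1 hN
  have hNpos : (0 : ℝ) < N := by exact_mod_cast (show 0 < N by omega)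
  have hrpow : (0 : ℝ) < (N : ℝ) ^ (-(1 : ℝ) / 4) := Real.rpow_pos_of_pos hNpos _
  by_cases hdev : irrRatio d N ≤ μ ^ 2
  · have : 0 ≤ K₁ * (N : ℝ) ^ (-(1 : ℝ) / 4) := mul_nonneg hK₁0 hrpow.le
    linarith
  · rw [not_le] at hdev
    set u := irrRatio d N - μ ^ 2 with hu
    have hu0 : 0 < u := by rw [hu]; linarith
    have hdev' : μ ^ 2 + u ≤ ((irrFam d (N + 2)).card : ℝ) / (irrFam d N).card := by
      rw [irrFam_ratio_eq_irrRatio hN1, hu]; linarith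
    have h := upper_rate_core (b := fun n => ((irrFam d n).card : ℝ)) (irrFam_card_pos d) hμ hD1 hc0 hK
      (card_irrFam_le_pow (d := d)) (exp_mul_pow_le_irrFam d) hN hN1 hu0 hdev'
    -- `u N^{1/4} ≤ K₁ ⇒ u ≤ K₁ N^{-1/4}`
    have hN14 : (0 : ℝ) < (N : ℝ) ^ ((1 : ℝ) / 4) := Real.rpow_pos_of_pos hNpos _
    have hinv : (N : ℝ) ^ (-(1 : ℝ) / 4) = ((N : ℝ) ^ ((1 : ℝ) / 4))⁻¹ := by
      rw [← Real.rpow_neg hNpos.le]; norm_num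
    rw [hinv, ← div_eq_mul_inv, le_div_iff₀ hN14]
    exact h

/-! ### S3 — the lower rate by backward propagation (abstract; delivered by a-p1 g5) -/

/-- **R52-S3 (the lever)**: for a positive sequence with the additive Kesten step, the envelope `e^{-c√n}μ^n ≤ a_n ≤ μ^n`
forces the LOWER rate `φ_N − μ² ≥ −K N^{-1/4}` by backward propagation of a deviation over `≍ uN/D` steps.
[cite: MadrasSlade1993, Lemma 7.3.1 (proof, backward propagation) and Theorem 7.3.4 (method)] -/
theorem backwardEnvelope_rate {a : ℕ → ℝ} {μ D c : ℝ} {N₁ : ℕ} (ha : ∀ n, 0 < a n) (hμ : 1 ≤ μ)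
    (hD1 : 1 ≤ D) (hc0 : 0 ≤ c)
    (hK : ∀ n : ℕ, N₁ ≤ n → a (n + 2) / a n - D / n ≤ a (n + 4) / a (n + 2))
    (hhi : ∀ n : ℕ, a n ≤ μ ^ n)
    (hlo : ∀ n : ℕ, 3 ≤ n → Real.exp (-(c * Real.sqrt n)) * μ ^ n ≤ a n) :
    ∃ K : ℝ, 0 ≤ K ∧ ∃ N₀ : ℕ, ∀ N : ℕ, N₀ ≤ N →
      -(K * (N : ℝ) ^ (-(1 : ℝ) / 4)) ≤ a (N + 2) / a N - μ ^ 2 := by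
  set φ : ℕ → ℝ := fun n => a (n + 2) / a n with hφ
  have hφpos : ∀ n, 0 < φ n := fun n => div_pos (ha _) (ha _)
  have hμ0 : 0 < μ := lt_of_lt_of_le one_pos hμ
  have hD0 : 0 < D := lt_of_lt_of_le one_pos hD1
  -- the two constants
  set K₁ : ℝ := Real.sqrt (8 * Real.sqrt 2 * D * μ ^ 2 * c) with hK₁
  set K₂ : ℝ := 16 * Real.sqrt 2 * μ ^ 2 * c with hK₂
  have hK₁0 : 0 ≤ K₁ := Real.sqrt_nonneg _
  have hK₂0 : 0 ≤ K₂ := by rw [hK₂]; positivity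
  refine ⟨max K₁ K₂, le_max_of_le_left hK₁0, max (2 * N₁ + 2) 8, fun N hN => ?_⟩
  have hN₁ : 2 * N₁ + 2 ≤ N := le_trans (le_max_left _ _) hN
  have hN8 : 8 ≤ N := le_trans (le_max_right _ _) hN
  have hNr : (8 : ℝ) ≤ N := by exact_mod_cast hN8
  have hN0 : (0 : ℝ) < N := by linarith
  have hrpow0 : (0 : ℝ) ≤ (N : ℝ) ^ (-(1 : ℝ) / 4) := Real.rpow_nonneg hN0.le _
  -- WLOG a deviation below
  by_cases hdev : μ ^ 2 ≤ φ N
  · have : 0 ≤ max K₁ K₂ * (N : ℝ) ^ (-(1 : ℝ) / 4) := mul_nonneg (le_max_of_le_left hK₁0) hrpow0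
    change -(max K₁ K₂ * (N : ℝ) ^ (-(1 : ℝ) / 4)) ≤ φ N - μ ^ 2
    linarith
  rw [not_le] at hdev
  set u : ℝ := μ ^ 2 - φ N with hu
  have hu0 : 0 < u := by rw [hu]; linarith
  have huμ : u < μ ^ 2 := by rw [hu]; linarith [hφpos N]
  -- it suffices to bound `u ≤ max K₁ K₂ · N^{-1/4}`
  suffices hmain : u ≤ max K₁ K₂ * (N : ℝ) ^ (-(1 : ℝ) / 4) by
    change -(max K₁ K₂ * (N : ℝ) ^ (-(1 : ℝ) / 4)) ≤ φ N - μ ^ 2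
    linarith
  -- the number of backward steps
  set M : ℕ := min (Nat.floor (u * N / (4 * D))) (Nat.floor ((N : ℝ) / 4)) with hM
  have hMu : (M : ℝ) ≤ u * N / (4 * D) :=
    (Nat.cast_le.2 (min_le_left _ _)).trans (Nat.floor_le (by positivity))
  have hMN : (M : ℝ) ≤ (N : ℝ) / 4 := (Nat.cast_le.2 (min_le_right _ _)).trans (Nat.floor_le (by positivity))
  have hMN' : 2 * M ≤ N / 2 := by
    have : (M : ℝ) * 4 ≤ N := by linarith
    have h' : M * 4 ≤ N := by exact_mod_cast this
    omega
  have hm0 : N₁ ≤ N - 2 * M ∧ 1 ≤ N - 2 * M := by omega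
  -- backward bound: `φ_{N-2j} ≤ μ² − u/2` for `j ≤ M`
  have hK' : ∀ n, N₁ ≤ n → (0 : ℝ) ≤ φ n → φ n - D / n ≤ φ (n + 2) := fun n hn _ => by
    have := hK n hn; simp only [hφ] at this ⊢; rw [show n + 2 + 2 = n + 4 by ring]; exact this
  have hback : ∀ j, j ≤ M → φ (N - 2 * j) ≤ μ ^ 2 - u / 2 := by
    intro j hj
    have h1 := kesten_iter_backward_of_threshold (φ := φ) (B := D) (t := 0) (T := μ ^ 2 - u) hD0.le (by linarith)
      hK' j (N - 2 * j) (by omega) (by omega) (by rw [show N - 2 * j + 2 * j = N by omega, hu]; linarith)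
    -- `j D/(N − 2j) ≤ M D/(N/2) = 2MD/N ≤ u/2`
    have hden : (N : ℝ) / 2 ≤ ((N - 2 * j : ℕ) : ℝ) := by
      have : (((N - 2 * j : ℕ) : ℝ)) = (N : ℝ) - 2 * (j : ℝ) := by
        rw [Nat.cast_sub (by omega)]; push_cast; ring
      rw [this]
      have hjM : (j : ℝ) ≤ M := by exact_mod_cast hj
      linarith
    have hMD : (M : ℝ) * D ≤ u * N / 4 := by
      have h := hMu
      rw [le_div_iff₀ (by positivity)] at h
      rw [le_div_iff₀ (by norm_num)]
      linarith
    have hjD : (j : ℝ) * D / ((N - 2 * j : ℕ) : ℝ) ≤ u / 2 := by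
      have hjM : (j : ℝ) ≤ M := by exact_mod_cast hj
      calc (j : ℝ) * D / ((N - 2 * j : ℕ) : ℝ) ≤ (M : ℝ) * D / ((N : ℝ) / 2) := by
            gcongr
        _ = 2 * (M * D) / N := by field_simp
        _ ≤ 2 * (u * N / 4) / N := by gcongr
        _ = u / 2 := by field_simp; ring
    linarith
  -- telescoping: `a (N+2) ≤ a (N − 2M) · (μ² − u/2)^{M+1}`
  have hT0 : 0 ≤ μ ^ 2 - u / 2 := by linarith
  have htel : ∀ i, i ≤ M + 1 → a (N - 2 * M + 2 * i) ≤ a (N - 2 * M) * (μ ^ 2 - u / 2) ^ i := by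
    intro i
    induction i with
    | zero => intro _; simp
    | succ i ih =>
      intro hi
      have h1 := ih (by omega)
      have h2 : φ (N - 2 * M + 2 * i) ≤ μ ^ 2 - u / 2 := by
        have := hback (M - i) (by omega)
        rwa [show N - 2 * (M - i) = N - 2 * M + 2 * i by omega] at this
      have h3 : a (N - 2 * M + 2 * (i + 1)) = φ (N - 2 * M + 2 * i) * a (N - 2 * M + 2 * i) := by
        simp only [hφ]
        rw [show N - 2 * M + 2 * i + 2 = N - 2 * M + 2 * (i + 1) by ring, div_mul_cancel₀ _ (ha _).ne']
      rw [h3, pow_succ]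
      calc φ (N - 2 * M + 2 * i) * a (N - 2 * M + 2 * i)
          ≤ (μ ^ 2 - u / 2) * (a (N - 2 * M) * (μ ^ 2 - u / 2) ^ i) :=
            mul_le_mul h2 h1 (ha _).le hT0
        _ = _ := by ring
  have hup : a (N + 2) ≤ μ ^ (N - 2 * M) * (μ ^ 2 - u / 2) ^ (M + 1) := by
    have h := htel (M + 1) le_rfl
    rw [show N - 2 * M + 2 * (M + 1) = N + 2 by omega] at h
    exact h.trans (mul_le_mul_of_nonneg_right (hhi _) (pow_nonneg hT0 _))
  -- against the lower envelope at `N + 2`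
  have hdown := hlo (N + 2) (by omega)
  -- `(μ² − u/2)^{M+1} = μ^{2(M+1)} (1 − u/(2μ²))^{M+1} ≤ μ^{2(M+1)} e^{−(M+1) u/(2μ²)}`
  set x : ℝ := u / (2 * μ ^ 2) with hx
  have hx0 : 0 ≤ x := by positivity
  have hx1 : 0 ≤ 1 - x := by
    rw [hx, sub_nonneg, div_le_one (by positivity)]; nlinarith
  have hfac : μ ^ 2 - u / 2 = μ ^ 2 * (1 - x) := by rw [hx]; field_simp
  have hexp1 : (1 - x) ^ (M + 1) ≤ Real.exp (-(((M + 1 : ℕ) : ℝ) * x)) := by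
    have h1 : 1 - x ≤ Real.exp (-x) := by have := Real.add_one_le_exp (-x); linarith
    calc (1 - x) ^ (M + 1) ≤ Real.exp (-x) ^ (M + 1) := pow_le_pow_left₀ hx1 h1 _
      _ = Real.exp (-(((M + 1 : ℕ) : ℝ) * x)) := by rw [← Real.exp_nat_mul]; ring_nf
  have hchain : Real.exp (-(c * Real.sqrt ((N + 2 : ℕ) : ℝ))) * μ ^ (N + 2) ≤
      μ ^ (N + 2) * Real.exp (-(((M + 1 : ℕ) : ℝ) * x)) := by
    calc Real.exp (-(c * Real.sqrt ((N + 2 : ℕ) : ℝ))) * μ ^ (N + 2) ≤ a (N + 2) := hdown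
      _ ≤ μ ^ (N - 2 * M) * (μ ^ 2 - u / 2) ^ (M + 1) := hup
      _ = μ ^ (N + 2) * (1 - x) ^ (M + 1) := by
          rw [hfac, mul_pow, ← pow_mul, ← mul_assoc, ← pow_add, show N - 2 * M + 2 * (M + 1) = N + 2 by omega]
      _ ≤ μ ^ (N + 2) * Real.exp (-(((M + 1 : ℕ) : ℝ) * x)) :=
          mul_le_mul_of_nonneg_left hexp1 (pow_nonneg hμ0.le _)
  -- hence `(M+1) x ≤ c √(N+2)`
  have hMx : ((M + 1 : ℕ) : ℝ) * x ≤ c * Real.sqrt ((N + 2 : ℕ) : ℝ) := by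
    have hμN : 0 < μ ^ (N + 2) := pow_pos hμ0 _
    have h1 : Real.exp (-(c * Real.sqrt ((N + 2 : ℕ) : ℝ))) ≤ Real.exp (-(((M + 1 : ℕ) : ℝ) * x)) := by
      have := hchain; rw [mul_comm (μ ^ (N + 2))] at this
      exact le_of_mul_le_mul_right this hμN
    have := Real.exp_le_exp.1 h1
    linarith
  -- `√(N+2) ≤ √2 · √N` (`N ≥ 2`)
  have hsqrt : Real.sqrt ((N + 2 : ℕ) : ℝ) ≤ Real.sqrt 2 * Real.sqrt N := by
    rw [← Real.sqrt_mul (by norm_num)]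
    exact Real.sqrt_le_sqrt (by push_cast; linarith)
  have hMx' : ((M : ℝ) + 1) * u ≤ 2 * μ ^ 2 * c * (Real.sqrt 2 * Real.sqrt N) := by
    have h1 : ((M : ℝ) + 1) * x ≤ c * (Real.sqrt 2 * Real.sqrt N) := by
      have : ((M + 1 : ℕ) : ℝ) = (M : ℝ) + 1 := by push_cast; ring
      rw [← this]
      exact hMx.trans (mul_le_mul_of_nonneg_left hsqrt hc0)
    have h2 : ((M : ℝ) + 1) * u = 2 * μ ^ 2 * (((M : ℝ) + 1) * x) := by rw [hx]; field_simp
    rw [h2]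
    nlinarith [pow_pos hμ0 2]
  have hsN : 0 < Real.sqrt (N : ℝ) := Real.sqrt_pos.2 hN0
  have hsN2 : Real.sqrt (N : ℝ) ^ 2 = N := Real.sq_sqrt hN0.le
  -- `N^{-1/4} = 1/√(√N)` bookkeeping: we show `u ≤ K · N^{-1/4}` via `u · N^{1/4} ≤ K`
  have hquarter : (N : ℝ) ^ (-(1 : ℝ) / 4) = (Real.sqrt (Real.sqrt N))⁻¹ := by
    rw [Real.sqrt_eq_rpow, Real.sqrt_eq_rpow, ← Real.rpow_mul hN0.le, ← Real.rpow_neg hN0.le]; norm_num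
  have hq0 : 0 < Real.sqrt (Real.sqrt (N : ℝ)) := Real.sqrt_pos.2 hsN
  have hq2 : Real.sqrt (Real.sqrt (N : ℝ)) ^ 2 = Real.sqrt N := Real.sq_sqrt hsN.le
  have hq4 : Real.sqrt (Real.sqrt (N : ℝ)) ^ 4 = N := by
    rw [show (4 : ℕ) = 2 * 2 by norm_num, pow_mul, hq2, hsN2]
  rw [hquarter, ← div_eq_mul_inv, le_div_iff₀ hq0]
  -- the two cases
  rcases le_or_gt (Nat.floor (u * N / (4 * D))) (Nat.floor ((N : ℝ) / 4)) with hcase | hcase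
  · -- Case A: `M = ⌊uN/(4D)⌋`, so `M + 1 > uN/(4D)` and `u² N/(4D) < 2√2 μ² c √N`
    have hMA : M = Nat.floor (u * N / (4 * D)) := by rw [hM, min_eq_left hcase]
    have hM1 : u * N / (4 * D) < (M : ℝ) + 1 := by rw [hMA]; exact Nat.lt_floor_add_one _
    have h1 : u * (u * N / (4 * D)) ≤ 2 * μ ^ 2 * c * (Real.sqrt 2 * Real.sqrt N) :=
      calc u * (u * N / (4 * D)) ≤ u * ((M : ℝ) + 1) := mul_le_mul_of_nonneg_left hM1.le hu0.le
        _ = ((M : ℝ) + 1) * u := by ring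
        _ ≤ _ := hMx'
    -- `u² ≤ 8√2 D μ² c / √N`, i.e. `(u · N^{1/4})² ≤ K₁²`
    have h2 : (u * Real.sqrt (Real.sqrt (N : ℝ))) ^ 2 ≤ K₁ ^ 2 := by
      rw [hK₁, Real.sq_sqrt (by positivity), mul_pow, hq2]
      have h3 : u ^ 2 * N ≤ 8 * Real.sqrt 2 * D * μ ^ 2 * c * Real.sqrt N := by
        have := h1
        rw [show u * (u * N / (4 * D)) = u ^ 2 * N / (4 * D) by ring, div_le_iff₀ (by positivity)] at this
        have e : 2 * μ ^ 2 * c * (Real.sqrt 2 * Real.sqrt N) * (4 * D) = 8 * Real.sqrt 2 * D * μ ^ 2 * c * Real.sqrt N := by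
          ring
        rw [e] at this
        exact this
      -- divide by `√N`: `u² √N ≤ 8√2 D μ² c`
      have h4 : u ^ 2 * Real.sqrt N * Real.sqrt N ≤ 8 * Real.sqrt 2 * D * μ ^ 2 * c * Real.sqrt N := by
        rw [mul_assoc, ← pow_two, hsN2]; exact h3
      exact le_of_mul_le_mul_right h4 hsN
    have h3 : u * Real.sqrt (Real.sqrt (N : ℝ)) ≤ K₁ := by
      have := Real.sqrt_le_sqrt h2
      rwa [Real.sqrt_sq (by positivity), Real.sqrt_sq hK₁0] at this
    exact h3.trans (le_max_left _ _)
  · -- Case B: `M = ⌊N/4⌋ ≥ N/4 − 1 ≥ N/8`, so `u ≤ 16√2 μ² c/√N ≤ K₂/N^{1/4}`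
    have hMB : M = Nat.floor ((N : ℝ) / 4) := by rw [hM, min_eq_right hcase.le]
    have hM8 : (N : ℝ) / 8 ≤ (M : ℝ) + 1 := by
      have := Nat.lt_floor_add_one ((N : ℝ) / 4); rw [← hMB] at this; linarith
    have h1 : (N : ℝ) / 8 * u ≤ 2 * μ ^ 2 * c * (Real.sqrt 2 * Real.sqrt N) :=
      le_trans (mul_le_mul_of_nonneg_right hM8 hu0.le) hMx'
    -- `u · N ≤ 16√2 μ² c √N`, so `u √N ≤ 16 √2 μ² c = K₂`, and `u N^{1/4} ≤ u √N` (as `N^{1/4} ≤ √N`, `N ≥ 1`)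
    have h2 : u * Real.sqrt N * Real.sqrt N ≤ K₂ * Real.sqrt N := by
      rw [mul_assoc, ← pow_two, hsN2, hK₂]
      have e : 16 * Real.sqrt 2 * μ ^ 2 * c * Real.sqrt N = 8 * (2 * μ ^ 2 * c * (Real.sqrt 2 * Real.sqrt N)) := by ring
      rw [e]
      linarith
    have h3 : u * Real.sqrt N ≤ K₂ := le_of_mul_le_mul_right h2 hsN
    have h4 : Real.sqrt (Real.sqrt (N : ℝ)) ≤ Real.sqrt N := by
      apply Real.sqrt_le_sqrt
      -- `√N ≤ N` for `N ≥ 1`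
      have h1N : 1 ≤ Real.sqrt (N : ℝ) := Real.one_le_sqrt.2 (by linarith)
      calc Real.sqrt (N : ℝ) = Real.sqrt N * 1 := (mul_one _).symm
        _ ≤ Real.sqrt N * Real.sqrt N := mul_le_mul_of_nonneg_left h1N hsN.le
        _ = N := Real.mul_self_sqrt hN0.le
    calc u * Real.sqrt (Real.sqrt (N : ℝ)) ≤ u * Real.sqrt N := mul_le_mul_of_nonneg_left h4 hu0.le
      _ ≤ K₂ := h3
      _ ≤ max K₁ K₂ := le_max_right _ _

/-- **R52-S3λ**: the lower rate for `λ` (S3 applied to `a_n = |irrFam d n|` with S1 transported).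
[cite: MadrasSlade1993, Lemma 7.3.1 and Theorem 7.3.4 (method), Corollary 3.1.6] -/
theorem irrRatio_lowerRate (d : ℕ) : ∃ K : ℝ, 0 ≤ K ∧ ∃ N₀ : ℕ, ∀ N : ℕ, N₀ ≤ N →
    -(K * (N : ℝ) ^ (-(1 : ℝ) / 4)) ≤ irrRatio d N - connectiveConstant (d + 2) ^ 2 := by
  have hμ1 := one_le_connectiveConstant (d + 2)
  set μ := connectiveConstant (d + 2) with hμdef
  set c : ℝ := 3 * (count (d + 2) 1 : ℝ) + 48 + 5 * μ with hc
  have hc0 : 0 ≤ c := by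
    rw [hc]; have : (0 : ℝ) ≤ count (d + 2) 1 := Nat.cast_nonneg _; nlinarith [connectiveConstant_pos (d + 2)]
  obtain ⟨D, hD1, N₁, hN₁1, hK⟩ := irrFam_kesten_additive d
  obtain ⟨K, hK0, N₀, h⟩ := backwardEnvelope_rate (a := fun n => ((irrFam d n).card : ℝ)) (irrFam_card_pos d) hμ1 hD1 hc0 hK
    (card_irrFam_le_pow (d := d)) (fun n _ => exp_mul_pow_le_irrFam d n)
  refine ⟨K, hK0, max N₀ 1, fun N hN => ?_⟩
  have h1 := h N (le_trans (le_max_left _ _) hN)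
  rwa [irrFam_ratio_eq_irrRatio (le_trans (le_max_right _ _) hN)] at h1

/-! ### Assembly -/

/-- R52 ASSEMBLY (planner's, verbatim): upper + lower one-sided rates give `IrrTwoStepRate d K N₀`.
[cite: MadrasSlade1993, Theorem 7.3.4 (statement shape)] -/
theorem irrTwoStepRate_of_rates (d : ℕ)
    (hup : ∃ K : ℝ, 0 ≤ K ∧ ∃ N₀ : ℕ, ∀ N : ℕ, N₀ ≤ N →
      irrRatio d N - connectiveConstant (d + 2) ^ 2 ≤ K * (N : ℝ) ^ (-(1 : ℝ) / 4))
    (hlo : ∃ K : ℝ, 0 ≤ K ∧ ∃ N₀ : ℕ, ∀ N : ℕ, N₀ ≤ N →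
      -(K * (N : ℝ) ^ (-(1 : ℝ) / 4)) ≤ irrRatio d N - connectiveConstant (d + 2) ^ 2) :
    ∃ K : ℝ, ∃ N₀ : ℕ, IrrTwoStepRate d K N₀ := by
  obtain ⟨K₁, _, N₁, h₁⟩ := hup
  obtain ⟨K₂, _, N₂, h₂⟩ := hlo
  refine ⟨max K₁ K₂, max N₁ N₂, fun N hN => ?_⟩
  have hx : (0 : ℝ) ≤ (N : ℝ) ^ (-(1 : ℝ) / 4) := Real.rpow_nonneg (Nat.cast_nonneg N) _
  have hu := h₁ N (le_trans (le_max_left _ _) hN)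
  have hl := h₂ N (le_trans (le_max_right _ _) hN)
  have e₁ : K₁ * (N : ℝ) ^ (-(1 : ℝ) / 4) ≤ max K₁ K₂ * (N : ℝ) ^ (-(1 : ℝ) / 4) :=
    mul_le_mul_of_nonneg_right (le_max_left _ _) hx
  have e₂ : K₂ * (N : ℝ) ^ (-(1 : ℝ) / 4) ≤ max K₁ K₂ * (N : ℝ) ^ (-(1 : ℝ) / 4) :=
    mul_le_mul_of_nonneg_right (le_max_right _ _) hx
  rw [abs_le]
  constructor <;> linarith

/-- **R52 «IRR-RATIO-RATE»**: `∃ K N₀, ∀ N ≥ N₀, |λ_{N+2}/λ_N − μ²| ≤ K N^{-1/4}` on every `ℤ^{d+2}`.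
[cite: MadrasSlade1993, Theorem 7.3.4 (p. 248: printed ratio LIMITS for c_N, c_N(0,x), q_{2N}, b_N; none for λ_N) and §7.5 Notes (7.5.1)–(7.5.2) (p. 255: printed RATES for c_N, c_N(0,x) only; here a rate for λ_N — lane route R52)] -/
theorem irrBridgeTwoStepRate (d : ℕ) : ∃ K : ℝ, ∃ N₀ : ℕ, IrrTwoStepRate d K N₀ :=
  irrTwoStepRate_of_rates d (irrRatio_upperRate d) (irrRatio_lowerRate d)

end Literature.Probability.RandomPlanarGeometry.SAW.Zd

end
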